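import Mathlib
import HarnessLib
import Summits.NavierStokesRegularity.NavierStokesRegularity.Theorems.TaylorModelRungThreeCertificateFormat
import Summits.NavierStokesRegularity.NavierStokesRegularity.Theorems.TaylorModelRungThreeCertificateSoundBridge
import Summits.NavierStokesRegularity.NavierStokesRegularity.Theorems.TaylorModelRungThreeCertificateSoundField
import Summits.NavierStokesRegularity.NavierStokesRegularity.Theorems.TaylorModelRungThreeCertificateSoundNode
import Summits.NavierStokesRegularity.NavierStokesRegularity.Theorems.TaylorModelRungThreeCertificateSoundChain
import Summits.NavierStokesRegularity.NavierStokesRegularity.Theorems.TaylorModelRungThreeReadoutCoords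

/-!
# Crux K1b-DR (stmt-NavierStokesRegularity-23954), line `taylor-model` — certificate SOUNDNESS, part 6: the ENTRY
# clause of `Chain` from an LP-duality (Farkas) certificate

The entry-decomposition clause of `TaylorChain.CertData.Chain` (named `CertTables.EntryClause` in part 5) asks that
every point `q` of the entry polytope `{|ℓ j l q - ctr j l| ≤ rad j l}` be written `x j 0 + Cm j 0 ξ + e` with `ξ` in
the `rP j 0`-box, `e` in the `E j 0`-ball and `Cm ξ + e` in the `dm j`-ball. CERT-CONTRACT-23954 §4 reduces it, with
`ξ := Ci j 0 (trunc q - x j 0)` and `e := 0`, to bounds of LINEAR functionals over the polytope, certified by DUAL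
MULTIPLIERS: the engine emits, per stage and per target functional (the `n` rows of `Ci j 0` and the `n` coordinate
functionals), a vector `λ` with `Σ_l λ_l · ell_l = target` EXACTLY and
`|Σ_l λ_l ctr_l - target (x j 0)| + Σ_l |λ_l| rad_l` below the required radius. This file fixes the format of that proof data (`EntryAux`), the Boolean checker
(`checkEntryStage`, `checkEntry`) and proves its soundness `entry_of_check`; with part 5 this gives `Chain` from
`checkChain ∧ checkPolyTails ∧ checkEntry` (+ `CoefOK`): `chain_of_checks`. MODEL-lattice rung TL-M3; nothing here is a
statement about the Navier–Stokes equations.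
-/

-- the sub-problem namespace repeats the summit name by design (D-0017)
set_option linter.dupNamespace false

namespace Summit.NavierStokesRegularity.NavierStokesRegularity.Theorems.TaylorModelCert

open scoped BigOperators
open Literature.Analysis.FluidPDE.TaoCascade Literature.Analysis.FluidPDE.TaoCascade.TaylorChain
open Summit.NavierStokesRegularity.NavierStokesRegularity.Theorems.TaylorModelReadout (trunc trunc_apply trunc_eq_self
  wsupp_trunc)

/-- ENTRY PROOF DATA (CERT-CONTRACT-23954 §4, "Farkas multipliers"): per stage `j`, for each window coordinate `c`, a
vector of multipliers over the listed faces certifying the bound of row `c` of `Ci j 0` (`lamCi`) and of the coordinate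
functional `e_c` (`lamId`) over the entry polytope. Index order `[j][c][l]`, junk `0`. [folklore] -/
structure EntryAux (K : Type) where
  lamCi : List (List (List K))
  lamId : List (List (List K))

/-- Entry `[j][c][l]` of a triple list (junk `0`). [folklore] -/
def lam3 {K : Type} [Field K] (L : List (List (List K))) (j c l : ℕ) : K := ((L.getD j []).getD c []).getD l 0

namespace CertTables

section Defs

variable {K : Type} [Field K] [LinearOrder K]

/-- ENTRY CHECK at stage `j`: non-negative weights; for every row `c` of `Ci j 0` and every coordinate functional the
exact multiplier identity against the listed faces and the dual bound (`≤ rP j 0 c`, resp. `≤ dm j · ω c`).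
[folklore] -/
def checkEntryStage (T : CertTables K) (E : EntryAux K) (j : ℕ) : Bool :=
  let G := T.stage j
  let N := T.node j 0
  let nl := G.ell.length
  allN T.n (fun c => decide (0 ≤ T.wgt j c)) &&
  allN T.n (fun c =>
    allN T.n (fun c' => decide (sumN nl (fun l => lam3 E.lamCi j c l * vget (G.ell.getD l []) c') = mget N.Ci c c')) &&
    decide (|sumN nl (fun l => lam3 E.lamCi j c l * vget G.ctr l) - sumN T.n (fun c' => mget N.Ci c c' * vget N.x c')| +
      sumN nl (fun l => |lam3 E.lamCi j c l| * vget G.rad l) ≤ vget N.rP c)) &&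
  allN T.n (fun c =>
    allN T.n (fun c' => decide (sumN nl (fun l => lam3 E.lamId j c l * vget (G.ell.getD l []) c') =
      if c' = c then 1 else 0)) &&
    decide (|sumN nl (fun l => lam3 E.lamId j c l * vget G.ctr l) - vget N.x c| +
      sumN nl (fun l => |lam3 E.lamId j c l| * vget G.rad l) ≤ G.dm * T.wgt j c))

/-- ENTRY CHECK: all stages `j ≤ N₀`. [folklore] -/
def checkEntry (T : CertTables K) (E : EntryAux K) : Bool := allN (T.N₀ + 1) fun j => T.checkEntryStage E j

end Defs

section Sound

variable {K : Type} [Field K] [LinearOrder K] [IsStrictOrderedRing K] {φ : K →+* ℝ} (hφ : Monotone φ)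
  (T : CertTables K)
include hφ

omit [LinearOrder K] [IsStrictOrderedRing K] hφ in
/-- Window values of a truncation. [folklore] -/
theorem wv_trunc (q : Fin 4 → ℤ → ℝ) {c : ℕ} (hc : c < T.n) : T.wv (trunc (T.toCertData φ) q) c = T.wv q c := by
  unfold wv
  rw [trunc_apply, toCertData_Kb, toCertData_Ka, if_pos (T.InW_wk hc)]

omit [LinearOrder K] [IsStrictOrderedRing K] hφ in
/-- `dm` of a stage. [folklore] -/
theorem toCertData_dm (j : ℕ) : (T.toCertData φ).dm j = φ (T.stage j).dm := rfl

omit [LinearOrder K] [IsStrictOrderedRing K] hφ in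
/-- The functionals of the interpreted record in coordinates. [folklore] -/
theorem ell_apply (j l : ℕ) (y : Fin 4 → ℤ → ℝ) : (T.toCertData φ).ℓ j l y =
    ∑ c ∈ Finset.range T.n, φ (vget ((T.stage j).ell.getD l []) c) * T.wv y c :=
  T.covR_apply φ _ y

omit hφ in
/-- **LP duality bound**: if `|A l - ctr l| ≤ rad l` for the listed faces, then for any multipliers
`|Σ λ_l A_l - K₀| ≤ |Σ λ_l ctr_l - K₀| + Σ |λ_l| rad_l`. [folklore] -/
theorem farkas_bound (nl : ℕ) (lam A ctr rad : ℕ → ℝ) (K₀ : ℝ) (hP : ∀ l < nl, |A l - ctr l| ≤ rad l) :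
    |∑ l ∈ Finset.range nl, lam l * A l - K₀| ≤
      |∑ l ∈ Finset.range nl, lam l * ctr l - K₀| + ∑ l ∈ Finset.range nl, |lam l| * rad l := by
  have e : ∑ l ∈ Finset.range nl, lam l * A l - K₀ =
      (∑ l ∈ Finset.range nl, lam l * ctr l - K₀) + ∑ l ∈ Finset.range nl, lam l * (A l - ctr l) := by
    rw [Finset.sum_congr rfl fun l _ => mul_sub (lam l) (A l) (ctr l), Finset.sum_sub_distrib]; ring
  rw [e]
  refine (abs_add_le _ _).trans ?_
  gcongr
  refine (Finset.abs_sum_le_sum_abs _ _).trans (Finset.sum_le_sum fun l hl => ?_)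
  rw [abs_mul]
  exact mul_le_mul_of_nonneg_left (hP l (Finset.mem_range.1 hl)) (abs_nonneg _)

omit hφ in
/-- Exchange of the face sum and the coordinate sum under the multiplier identity:
`Σ_{c'} (target c') · w c' = Σ_l λ_l · (Σ_{c'} ell_l c' · w c')`. [folklore] -/
theorem sum_target_eq (j nl : ℕ) (lam : ℕ → K) (target : ℕ → K) (w : ℕ → ℝ)
    (hid : ∀ c' < T.n, sumN nl (fun l => lam l * vget ((T.stage j).ell.getD l []) c') = target c') :
    ∑ c' ∈ Finset.range T.n, φ (target c') * w c' =
      ∑ l ∈ Finset.range nl, φ (lam l) * ∑ c' ∈ Finset.range T.n, φ (vget ((T.stage j).ell.getD l []) c') * w c' := by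
  have : ∀ c' ∈ Finset.range T.n, φ (target c') * w c' =
      ∑ l ∈ Finset.range nl, φ (lam l) * (φ (vget ((T.stage j).ell.getD l []) c') * w c') := by
    intro c' hc'
    rw [← hid c' (Finset.mem_range.1 hc'), sumN_eq, map_sum, Finset.sum_mul]
    exact Finset.sum_congr rfl fun l _ => by rw [map_mul]; ring
  rw [Finset.sum_congr rfl this, Finset.sum_comm]
  exact Finset.sum_congr rfl fun l _ => by rw [Finset.mul_sum]

/-- **Soundness of the entry check at one stage**: with the node check at node `0` (exact frame inverse, `0 ≤ E`),
`checkEntryStage = true` gives the entry-decomposition clause `EntryClause` of `Chain`. [folklore] -/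
theorem entry_of_check (hco : T.CoefOK φ) (E : EntryAux K) {j : ℕ} (hN : T.checkNode j 0 = true)
    (hE : T.checkEntryStage E j = true) : EntryClause (T.toCertData φ) j := by
  obtain ⟨-, -, -, -, -, hEI, hEIE, -, -, -, -, -, -, hframe, -⟩ := T.node_of_checkNode hφ hco hN rfl
  simp only [checkEntryStage, Bool.and_eq_true] at hE
  obtain ⟨⟨hw, hCi⟩, hId⟩ := hE
  intro q hq
  -- the witnesses
  set v : Fin 4 → ℤ → ℝ := trunc (T.toCertData φ) q - (T.toCertData φ).x j 0 with hv
  have hvs : (T.toCertData φ).Wsupp v := by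
    intro i k hk
    show trunc (T.toCertData φ) q i k - (T.toCertData φ).x j 0 i k = 0
    rw [trunc_apply, toCertData_x, T.vecR_off φ _ i hk, sub_zero]
    exact if_neg hk
  have hwv : ∀ c < T.n, T.wv v c = T.wv q c - φ (vget (T.node j 0).x c) := by
    intro c hc
    show T.wv (trunc (T.toCertData φ) q) c - T.wv ((T.toCertData φ).x j 0) c = _
    rw [T.wv_trunc q hc, toCertData_x, T.wv_vecR φ _ hc]
  -- the polytope hypothesis in coordinates
  have hP : ∀ l < (T.stage j).ell.length,
      |(∑ c' ∈ Finset.range T.n, φ (vget ((T.stage j).ell.getD l []) c') * T.wv q c') - φ (vget (T.stage j).ctr l)| ≤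
        φ (vget (T.stage j).rad l) := by
    intro l _
    have := hq l
    rwa [T.ell_apply] at this
  refine ⟨(T.toCertData φ).Ci j 0 v, 0, fun i k hk1 hk2 => ⟨?_, ?_⟩, ?_, ?_⟩
  · -- the `rP j 0`-box for `ξ = Ci v`, by the dual certificate for row `c` of `Ci`
    have hk : -T.Kb ≤ k ∧ k ≤ T.Ka := ⟨hk1, hk2⟩
    have hlt := T.idx_lt_n i hk
    have h2 := (allN_eq_true.1 hCi) _ hlt
    rw [Bool.and_eq_true] at h2
    obtain ⟨hid, hbd⟩ := h2
    rw [toCertData_rP, T.vecR_apply, if_pos hk, ← T.wv_idx ((T.toCertData φ).Ci j 0 v) i hk, toCertData_Ci,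
      T.wv_linR φ _ _ hlt]
    have hid' : ∀ c' < T.n, sumN (T.stage j).ell.length (fun l => lam3 E.lamCi j (T.idx i k) l *
        vget ((T.stage j).ell.getD l []) c') = mget (T.node j 0).Ci (T.idx i k) c' :=
      fun c' hc' => of_decide_eq_true ((allN_eq_true.1 hid) c' hc')
    have e1 : ∑ c' ∈ Finset.range T.n, φ (mget (T.node j 0).Ci (T.idx i k) c') * T.wv v c' =
        ∑ l ∈ Finset.range (T.stage j).ell.length, φ (lam3 E.lamCi j (T.idx i k) l) *
            (∑ c' ∈ Finset.range T.n, φ (vget ((T.stage j).ell.getD l []) c') * T.wv q c') -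
          φ (sumN T.n fun c' => mget (T.node j 0).Ci (T.idx i k) c' * vget (T.node j 0).x c') := by
      rw [← T.sum_target_eq j _ _ _ _ hid', sumN_eq, map_sum, ← Finset.sum_sub_distrib]
      exact Finset.sum_congr rfl fun c' hc' => by rw [hwv c' (Finset.mem_range.1 hc'), map_mul]; ring
    rw [e1]
    refine (farkas_bound _ _ _ _ _ _ hP).trans ?_
    have hb := hφ (of_decide_eq_true hbd)
    simp only [map_add, map_sub, map_mul, map_abs hφ, sumN_eq, map_sum] at hb
    simpa only [map_mul, map_abs hφ, sumN_eq, map_sum] using hb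
  · -- the decomposition identity on the window
    have hk : -T.Kb ≤ k ∧ k ≤ T.Ka := ⟨hk1, hk2⟩
    rw [(hframe v).2.2 hvs |>.2]
    simp only [Pi.zero_apply, add_zero, hv, Pi.sub_apply, trunc_apply, toCertData_Kb, toCertData_Ka, if_pos hk,
      toCertData_x]
    ring
  · -- `e = 0` lies in the `E j 0`-ball
    rw [T.inBall_iff φ]
    intro c hc
    have h0 : (0 : ℝ) ≤ (T.toCertData φ).E j 0 := hEI.trans hEIE
    have : T.wv (0 : Fin 4 → ℤ → ℝ) c = 0 := rfl
    rw [this, abs_zero]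
    exact mul_nonneg h0 (by simpa using hφ (of_decide_eq_true ((allN_eq_true.1 hw) c hc)))
  · -- `Cm ξ + e = v` lies in the `dm j`-ball, by the dual certificate for the coordinate functionals
    rw [add_zero, (hframe v).2.2 hvs |>.2, T.inBall_iff φ]
    intro c hc
    have h2 := (allN_eq_true.1 hId) _ hc
    rw [Bool.and_eq_true] at h2
    obtain ⟨hid, hbd⟩ := h2
    have hid' : ∀ c' < T.n, sumN (T.stage j).ell.length (fun l => lam3 E.lamId j c l *
        vget ((T.stage j).ell.getD l []) c') = (if c' = c then 1 else 0) :=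
      fun c' hc' => of_decide_eq_true ((allN_eq_true.1 hid) c' hc')
    have e1 : T.wv v c = ∑ l ∈ Finset.range (T.stage j).ell.length, φ (lam3 E.lamId j c l) *
        (∑ c' ∈ Finset.range T.n, φ (vget ((T.stage j).ell.getD l []) c') * T.wv q c') - φ (vget (T.node j 0).x c) := by
      rw [← T.sum_target_eq j _ _ _ _ hid', hwv c hc]
      congr 1
      have : ∀ c' ∈ Finset.range T.n, φ (if c' = c then 1 else 0) * T.wv q c' = if c = c' then T.wv q c' else 0 := by
        intro c' _
        by_cases h : c' = c
        · subst h; simp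
        · simp [h, Ne.symm h]
      rw [Finset.sum_congr rfl this, Finset.sum_ite_eq, if_pos (Finset.mem_range.2 hc)]
    rw [e1]
    refine (farkas_bound _ _ _ _ _ _ hP).trans ?_
    have hb := hφ (of_decide_eq_true hbd)
    simp only [map_add, map_sub, map_mul, map_abs hφ, sumN_eq, map_sum] at hb
    simpa only [map_mul, map_abs hφ, sumN_eq, map_sum, toCertData_dm] using hb

/-- **`Chain` from the three Boolean checks** (format file's `checkChain`, part 5's `checkPolyTails`, this file's
`checkEntry`) under `CoefOK`. [folklore] -/
theorem chain_of_checks (hco : T.CoefOK φ) (E : EntryAux K) (hC : T.checkChain = true) (hTail : T.checkPolyTails = true)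
    (hEn : T.checkEntry E = true) : (T.toCertData φ).Chain := by
  refine T.chain_of_check hφ hco hC hTail fun j hj => ?_
  have hjlt : j < T.N₀ + 1 := Nat.lt_succ_of_le hj
  have hSt := (allN_eq_true.1 hC) j hjlt
  simp only [checkChainStage, Bool.and_eq_true] at hSt
  obtain ⟨⟨-, hnodes⟩, -⟩ := hSt
  have hS1 : 0 < (T.stage j).S + 1 := Nat.succ_pos _
  exact T.entry_of_check hφ hco E ((allN_eq_true.1 hnodes) 0 hS1) ((allN_eq_true.1 hEn) j hjlt)

end Sound

end CertTables

end Summit.NavierStokesRegularity.NavierStokesRegularity.Theorems.TaylorModelCert
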